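import Summits.ResolutionOfSingularities.ResolutionOfSingularities.Theorems.FrobeniusLadderFRationalResolutionFixedPointLocal
import Literature.RingTheory.KrullDimension.AffineDimension
import Mathlib.RingTheory.Localization.Finiteness
import Mathlib.RingTheory.Localization.Basic
import HarnessLib

/-!
# Crux `FrobeniusLadder.FRationalResolution` (stmt-ResolutionOfSingularities-15317), line `redirect`,
# stub `stub_diagonalizableQuotientResolution` — at a `D(A)`-fixed point `dim (S₀)_𝔮 = dim S_𝔔`
# (Kato's condition (2.1)(ii) for the monomial chart; linearisation step L3, brick 7)

For `S` of finite type over a field graded by a torsion group, a prime `𝔔 ⊇ S_a` (`a ≠ 0`) and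
`𝔮 = 𝔔 ∩ S₀`: `S_𝔔 = S ⊗_{S₀} (S₀)_𝔮` (`…FixedPointLocal.lean`) is a module-finite extension of
`(S₀)_𝔮` into which `(S₀)_𝔮` injects (localization is exact), so the two local rings have the same
Krull dimension (`Literature.RingTheory.KrullDimension.ringKrullDim_eq_of_isIntegral`). With a
homogeneous regular system of parameters `t` of `S_𝔔` (`…FixedPointGenerators.lean`, `S` regular)
this is `dim (S₀)_𝔮 = |t| = rank Mᵍᵖ` for the monomial chart `M`, whose face at `𝔮` is trivial.

* `algebraMap_atPrime_injective_of_fixed` — `(S₀)_𝔮 → S_𝔔` is injective;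
* `ringKrullDim_atPrime_eq_of_fixed` — **`dim (S₀)_𝔮 = dim S_𝔔`** (generic `IsLocalization.AtPrime`
  interfaces).

Honest label: brick of L3 (no stub closed). No definitions, no named facts, no sorry.
[folklore; cite: Matsumura1987, Thm. 9.4] [cite: Kato1994, Def. (2.1)]
-/

noncomputable section

-- single-problem summit: the doubled namespace component is forced
set_option linter.dupNamespace false

open IsLocalRing
open Literature.AlgebraicGeometry.Resolution.DiagonalizableQuotient

namespace Summit.ResolutionOfSingularities.ResolutionOfSingularities.Theorems.FRationalResolution.FixedPointDimension

universe u w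

variable {k : Type u} [Field k] {A : Type w} [DecidableEq A] [AddCommGroup A] {S : Type u}
  [CommRing S] [Algebra k S] (𝒮 : A → Submodule k S) [GradedAlgebra 𝒮]

section

variable (hA : AddMonoid.IsTorsion A) (𝔔 : Ideal S) [𝔔.IsPrime]
  (hfix : ∀ a : A, a ≠ 0 → ∀ s ∈ 𝒮 a, s ∈ 𝔔)
  (Rq : Type u) [CommRing Rq] [Algebra (𝒮 0) Rq]
  [IsLocalization.AtPrime Rq (𝔔.comap (algebraMap (𝒮 0) S))]
  (Lq : Type u) [CommRing Lq] [Algebra S Lq] [IsLocalization.AtPrime Lq 𝔔]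

include hA hfix in
/-- `Lq = S_𝔔` is also the localization of `S` at the image of `S₀ ∖ 𝔮`. [folklore] -/
theorem isLocalization_map_of_fixed :
    IsLocalization ((𝔔.comap (algebraMap (𝒮 0) S)).primeCompl.map (algebraMap (𝒮 0) S)) Lq := by
  set T : Submonoid S := (𝔔.comap (algebraMap (𝒮 0) S)).primeCompl.map (algebraMap (𝒮 0) S)
  haveI : IsLocalization.AtPrime (Localization T) 𝔔 :=
    FixedPointLocal.isLocalization_atPrime_of_fixed 𝒮 hA 𝔔 hfix (Localization T)
  exact IsLocalization.isLocalization_of_algEquiv T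
    (IsLocalization.algEquiv 𝔔.primeCompl (Localization T) Lq)

variable [Algebra Rq Lq] [Algebra (𝒮 0) Lq] [IsScalarTower (𝒮 0) S Lq] [IsScalarTower (𝒮 0) Rq Lq]

include hA hfix in
/-- The algebra map `(S₀)_𝔮 → S_𝔔` is the localization of `S₀ → S`. [folklore] -/
theorem algebraMap_eq_map_of_fixed :
    haveI := isLocalization_map_of_fixed 𝒮 hA 𝔔 hfix Lq
    algebraMap Rq Lq = IsLocalization.map Lq (algebraMap (𝒮 0) S)
      ((𝔔.comap (algebraMap (𝒮 0) S)).primeCompl.le_comap_map) := by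
  haveI := isLocalization_map_of_fixed 𝒮 hA 𝔔 hfix Lq
  apply IsLocalization.ringHom_ext (𝔔.comap (algebraMap (𝒮 0) S)).primeCompl
  rw [IsLocalization.map_comp, ← IsScalarTower.algebraMap_eq, ← IsScalarTower.algebraMap_eq]

include hA hfix in
/-- **`(S₀)_𝔮 → S_𝔔` is injective** at a fixed point (localization of the injective `S₀ → S`).
[folklore] -/
theorem algebraMap_atPrime_injective_of_fixed : Function.Injective (algebraMap Rq Lq) := by
  haveI := isLocalization_map_of_fixed 𝒮 hA 𝔔 hfix Lq
  rw [algebraMap_eq_map_of_fixed 𝒮 hA 𝔔 hfix Rq Lq]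
  exact IsLocalization.map_injective_of_injective (M := (𝔔.comap (algebraMap (𝒮 0) S)).primeCompl)
    (S := Rq) (Q := Lq) (algebraMap_gradeZero_injective 𝒮)

include hA hfix in
/-- **`dim (S₀)_𝔮 = dim S_𝔔` at a fixed point** (`S` of finite type over a field, torsion grading):
`S_𝔔` is module-finite over `(S₀)_𝔮` (`S` is finite over `S₀`, base change) and `(S₀)_𝔮 ⊆ S_𝔔`,
so integral extensions preserve Krull dimension. This is the dimension half of Kato's
log-regularity (2.1)(ii) for the monomial chart at a fixed point (the face is trivial).
[cite: Matsumura1987, Thm. 9.4] -/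
theorem ringKrullDim_atPrime_eq_of_fixed [Algebra.FiniteType k S] :
    ringKrullDim Rq = ringKrullDim Lq := by
  haveI := isLocalization_map_of_fixed 𝒮 hA 𝔔 hfix Lq
  haveI : IsLocalization (Algebra.algebraMapSubmonoid S (𝔔.comap (algebraMap (𝒮 0) S)).primeCompl)
    Lq := this
  haveI : Module.Finite (𝒮 0) S := module_finite_gradeZero 𝒮 hA
  haveI : Module.Finite Rq Lq :=
    Module.Finite.of_isLocalization (𝒮 0) S (𝔔.comap (algebraMap (𝒮 0) S)).primeCompl
  haveI : Algebra.IsIntegral Rq Lq := Algebra.IsIntegral.of_finite Rq Lq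
  exact Literature.RingTheory.KrullDimension.ringKrullDim_eq_of_isIntegral
    (algebraMap_atPrime_injective_of_fixed 𝒮 hA 𝔔 hfix Rq Lq)

end

end Summit.ResolutionOfSingularities.ResolutionOfSingularities.Theorems.FRationalResolution.FixedPointDimension

end
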